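import Mathlib
import HarnessLib
import Summits.Ventures.LatticeQCDFlow.Exactness.KickedProductTwoPoint
import Summits.Ventures.LatticeQCDFlow.Exactness.LocalDilationPushforward
import Summits.Ventures.LatticeQCDFlow.Exactness.SUNMultiStepLeapfrogHMC

/-!
# Multi-step leapfrog HMC on `SU(N)`: for short trajectories the proposed configuration, read through the logarithm, is an approximate dilation of the momentum, and its law dominates the chart kick

HONEST FRAMING: exact (Metropolis-corrected) sampling algorithms for lattice gauge theory;
figures of merit are autocorrelation/cost numbers at stated couplings and volumes; no
continuum-physics claim.

Venture `LatticeQCDFlow` (cell pub-lqcd), topic `Exactness`, FANOUT row 9 (eng-latcore, the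
engine `latflow.core.hmc.HMC(f, β, 'leapfrog').trajectory(τ, nstep)` / `sun_2d.HMC2D` on `SU(N)`,
`nstep ≥ 2`).  NEW WORK of the cell over the tree (`KickedProductTwoPoint.lean`: `plfTraj_fst_approx`,
`plfSmall`; `LocalDilationPushforward.lean`: `addHaar_inter_ball_le_of_approxOn`;
`SUNMultiStepLeapfrogHMC.lean`: `sunLeapfrogProposalN`, `sunPosMap`, `fst_sunLeapfrogProposalN_eq`;
`SUNProductTrajectory.lean`; `SUNLeapfrogHMCWalk.lean`: `pi_mulWalk`; `LeapfrogHMCDoeblin.smul_pi_le_pi`);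
nothing here is cited as a fact.  Printed counterparts, NAMED ONLY: Bou-Rabee–Sanz-Serna 2018
(irreducibility of HMC for short trajectories); Mackenzie 1989 (long trajectories: nothing asserted).

* §1 **`sunPosMap_approx`** — under the standing hypotheses at base `U`, `Θ ≤ ρ`, `plfSmall ≤ 1` and
  the logarithm defect `η_L` on a radius containing the trajectory (`2ΘC ≤ ρ_L`), for `‖p‖, ‖p'‖ ≤ R`:
  `‖sunPosMap p − sunPosMap p' − (nε)•(p − p')‖ ≤ ‖coordOf‖(2η_L + plfSmall)(nε‖ι‖)‖p − p'‖`;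
  **`norm_sunPosMap_zero_le`** — `‖sunPosMap 0‖ ≤ 4‖coordOf‖Θ₀C`, `Θ₀ = nε‖ι‖(2n+1)b` (the pure-kick
  trajectory).
* §2 `chartKickR ι hι μ r` — the normalised image of `μ|_{B(0,r)}` under the exponential (a
  probability law on `SU(N)`; `r = 1` is `SUNLeapfrogHMCWalk.chartKick`); `smul_chartKickR_le`.
* §3 **`sunLeapfrogProposalN_position_law`** — THE COMPARISON from base `U` on the unit momentum
  ball: if moreover `‖coordOf‖(2η_L + plfSmall)‖ι‖ ≤ 1/3` and `4‖coordOf‖Θ₀C ≤ nε/3`, then for every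
  measurable `B`, `c · ((⊗ chartKickR (nε/3)) · U)(B) ≤ μ^{⊗links} {p ∈ B̄(0,1) | (Ψ_n(U,p)).1 ∈ B}` with
  an explicit `c > 0` not depending on `U`.

NOT CLAIMED: anything when the smallness hypotheses fail (long trajectories); any value of the
radii (inverse function theorem); the kernel-level statements (next file).
-/

noncomputable section

namespace Summit.Ventures.LatticeQCDFlow.Exactness

open MeasureTheory ProbabilityTheory ProbabilityTheory.Kernel Set Metric Function NormedSpace
open Literature.MathematicalPhysics.QuantumFieldTheory (haarProbability)
open scoped ENNReal Matrix Matrix.Norms.Operator NNReal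

set_option backward.isDefEq.respectTransparency false

variable {n : Type*} [Fintype n] [DecidableEq n]
variable {E : Type*} [NormedAddCommGroup E] [NormedSpace ℝ E] [FiniteDimensional ℝ E]
variable (ι : E →ₗ[ℝ] Matrix n n ℂ) (hι : ∀ a, (ι a)ᴴ = -ι a ∧ (ι a).trace = 0) (hinj : Injective ι)
variable {L : Type*} [Fintype L]

/-! ## §1 The proposed configuration through the logarithm is an approximate dilation -/

section Approx

variable {u : L → Matrix.specialUnitaryGroup n ℂ} {ε : ℝ} {g : (L → Matrix.specialUnitaryGroup n ℂ) → L → E} {N : ℕ}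
variable {C b K ρ η ρL ηL : ℝ}

omit [DecidableEq n] in
/-- The total angle dominates the per-step angle (`n ≥ 1`). -/
theorem theta_le_Theta (hN : 1 ≤ N) {θ : ℝ} (hθ : 0 ≤ θ) : θ ≤ N * θ :=
  le_mul_of_one_le_left hθ (by exact_mod_cast hN)

/-- **The trajectory stays within `2ΘC` of `1`**: `‖W_n(p) − 1‖ ≤ 2ΘC` for `‖p‖ ≤ R` (`n ≥ 1`,
`Θ = nε‖J‖(R + (2n+1)b) ≤ ρ`). -/
theorem norm_plfTraj_fst_sub_one_le' (h : PLFBounds linkExp (sunJ ι) (algForce u g) sunGroupSet C b K ρ η)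
    (hε : 0 ≤ ε) (hN : 1 ≤ N) {R : ℝ} {p : L → E} (hp : ‖p‖ ≤ R)
    (hΘρ : N * (ε * ‖sunJ (L := L) ι‖ * (R + (2 * N + 1) * b)) ≤ ρ) :
    ‖(plfTraj linkExp (sunJ ι) (algForce u g) ε p N).1 - 1‖ ≤
      2 * (N * (ε * ‖sunJ (L := L) ι‖ * (R + (2 * N + 1) * b))) * C := by
  have hb0 := h.force_bound_nonneg
  have hR0 : 0 ≤ R := (norm_nonneg _).trans hp
  have hθ0 : 0 ≤ ε * ‖sunJ (L := L) ι‖ * (R + (2 * N + 1) * b) := by positivity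
  have hθρ : ε * ‖sunJ (L := L) ι‖ * (R + (2 * N + 1) * b) ≤ ρ := (theta_le_Theta hN hθ0).trans hΘρ
  refine (norm_plfTraj_fst_sub_one_le h ε p hp hε hθρ N le_rfl).trans (le_of_eq ?_)
  ring

/-- **`sunPosMap` IS AN APPROXIMATE DILATION BY THE TRAJECTORY LENGTH `nε`** on the momentum ball:
under the standing hypotheses at base `U`, `Θ ≤ ρ`, `plfSmall ≤ 1`, a logarithm defect `η_L ≥ 0` on
the radius `ρ_L ≥ 2ΘC`, for `‖p‖, ‖p'‖ ≤ R`: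
`‖sunPosMap p − sunPosMap p' − (nε)•(p − p')‖ ≤ ‖coordOf‖·(2η_L + plfSmall)·(nε‖J‖)·‖p − p'‖`. -/
theorem sunPosMap_approx (h : PLFBounds linkExp (sunJ ι) (algForce u g) sunGroupSet C b K ρ η)
    (hε : 0 ≤ ε) (hN : 1 ≤ N) {R : ℝ} {p p' : L → E} (hp : ‖p‖ ≤ R) (hp' : ‖p'‖ ≤ R)
    (hΘρ : N * (ε * ‖sunJ (L := L) ι‖ * (R + (2 * N + 1) * b)) ≤ ρ)
    (hS1 : plfSmall (sunJ (L := L) ι) C K η ε b R N ≤ 1) (hηL : 0 ≤ ηL)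
    (hlog : ∀ W W' : L → Matrix n n ℂ, ‖W - 1‖ ≤ ρL → ‖W' - 1‖ ≤ ρL →
      ‖linkLog W - linkLog W' - (W - W')‖ ≤ ηL * ‖W - W'‖)
    (hΘL : 2 * (N * (ε * ‖sunJ (L := L) ι‖ * (R + (2 * N + 1) * b))) * C ≤ ρL) :
    ‖sunPosMap ι hinj u ε g N p - sunPosMap ι hinj u ε g N p' - ((N : ℝ) * ε) • (p - p')‖ ≤
      ‖sunCoordOf (L := L) ι hinj‖ * (2 * ηL + plfSmall (sunJ (L := L) ι) C K η ε b R N) *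
        ((N : ℝ) * ε * ‖sunJ (L := L) ι‖) * ‖p - p'‖ := by
  set W := (plfTraj linkExp (sunJ ι) (algForce u g) ε p N).1 with hW
  set W' := (plfTraj linkExp (sunJ ι) (algForce u g) ε p' N).1 with hW'
  set S := plfSmall (sunJ (L := L) ι) C K η ε b R N with hSdef
  set τa : ℝ := (N : ℝ) * ε * ‖sunJ (L := L) ι‖ with hτa
  have hτa0 : 0 ≤ τa := by positivity
  have hN0 : 0 ≤ ‖p - p'‖ := norm_nonneg _
  have hW1 : ‖W - 1‖ ≤ ρL := (norm_plfTraj_fst_sub_one_le' ι h hε hN hp hΘρ).trans hΘL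
  have hW1' : ‖W' - 1‖ ≤ ρL := (norm_plfTraj_fst_sub_one_le' ι h hε hN hp' hΘρ).trans hΘL
  have happ : ‖W - W' - ((N : ℝ) * ε) • sunJ ι (p - p')‖ ≤ S * τa * ‖p - p'‖ := plfTraj_fst_approx h hε hp hp' hΘρ hS1
  have hlip : ‖W - W'‖ ≤ 2 * τa * ‖p - p'‖ := plfTraj_fst_lipschitz h hε hp hp' hΘρ hS1
  have hlg := hlog W W' hW1 hW1'
  -- read through the coordinates
  have hid : sunPosMap ι hinj u ε g N p - sunPosMap ι hinj u ε g N p' - ((N : ℝ) * ε) • (p - p') =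
      sunCoordOf ι hinj ((linkLog W - linkLog W' - (W - W')) + (W - W' - ((N : ℝ) * ε) • sunJ ι (p - p'))) := by
    have h1 : ((N : ℝ) * ε) • (p - p') = sunCoordOf ι hinj (((N : ℝ) * ε) • sunJ ι (p - p')) := by
      rw [map_smul, sunCoordOf_sunJ]
    rw [h1, sunPosMap, sunPosMap, ← map_sub, ← map_sub]
    congr 1
    abel
  rw [hid]
  calc ‖sunCoordOf ι hinj ((linkLog W - linkLog W' - (W - W')) + (W - W' - ((N : ℝ) * ε) • sunJ ι (p - p')))‖
      ≤ ‖sunCoordOf (L := L) ι hinj‖ * ‖(linkLog W - linkLog W' - (W - W')) + (W - W' - ((N : ℝ) * ε) • sunJ ι (p - p'))‖ :=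
        ContinuousLinearMap.le_opNorm _ _
    _ ≤ ‖sunCoordOf (L := L) ι hinj‖ * (ηL * (2 * τa * ‖p - p'‖) + S * τa * ‖p - p'‖) := by
        refine mul_le_mul_of_nonneg_left ((norm_add_le _ _).trans (add_le_add
          (hlg.trans (mul_le_mul_of_nonneg_left hlip hηL)) happ)) (norm_nonneg _)
    _ = ‖sunCoordOf (L := L) ι hinj‖ * (2 * ηL + S) * τa * ‖p - p'‖ := by ring

/-- **THE CENTRE**: the pure-kick trajectory stays close to `1`, so `‖sunPosMap 0‖ ≤ 4‖coordOf‖Θ₀C`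
with `Θ₀ = nε‖J‖(2n+1)b` (`Θ₀ ≤ ρ`, logarithm defect `η_L ≤ 1` on a radius `ρ_L ≥ 2Θ₀C`). -/
theorem norm_sunPosMap_zero_le (h : PLFBounds linkExp (sunJ ι) (algForce u g) sunGroupSet C b K ρ η)
    (hε : 0 ≤ ε) (hN : 1 ≤ N) (hΘρ : N * (ε * ‖sunJ (L := L) ι‖ * (0 + (2 * N + 1) * b)) ≤ ρ) (hηL1 : ηL ≤ 1)
    (hlog : ∀ W W' : L → Matrix n n ℂ, ‖W - 1‖ ≤ ρL → ‖W' - 1‖ ≤ ρL →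
      ‖linkLog W - linkLog W' - (W - W')‖ ≤ ηL * ‖W - W'‖)
    (hΘL : 2 * (N * (ε * ‖sunJ (L := L) ι‖ * (0 + (2 * N + 1) * b))) * C ≤ ρL) :
    ‖sunPosMap ι hinj u ε g N 0‖ ≤
      ‖sunCoordOf (L := L) ι hinj‖ * (4 * (N * (ε * ‖sunJ (L := L) ι‖ * (0 + (2 * N + 1) * b))) * C) := by
  set W := (plfTraj linkExp (sunJ ι) (algForce u g) ε (0 : L → E) N).1 with hW
  set Θ₀ : ℝ := N * (ε * ‖sunJ (L := L) ι‖ * (0 + (2 * N + 1) * b)) with hΘ₀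
  have hC0 : 0 ≤ C := zero_le_one.trans h.one_le
  have hW1 : ‖W - 1‖ ≤ 2 * Θ₀ * C := norm_plfTraj_fst_sub_one_le' ι h hε hN (p := 0) (by rw [norm_zero]) hΘρ
  have hρL0 : 0 ≤ ρL := le_trans (by positivity) (hW1.trans hΘL)
  have hlg := hlog W 1 (hW1.trans hΘL) (by rw [sub_self, norm_zero]; exact hρL0)
  rw [linkLog_one, sub_zero] at hlg
  have hlogW : ‖linkLog W‖ ≤ 2 * (2 * Θ₀ * C) := by
    calc ‖linkLog W‖ = ‖(linkLog W - (W - 1)) + (W - 1)‖ := by rw [sub_add_cancel]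
      _ ≤ ‖linkLog W - (W - 1)‖ + ‖W - 1‖ := norm_add_le _ _
      _ ≤ ηL * ‖W - 1‖ + ‖W - 1‖ := add_le_add hlg le_rfl
      _ ≤ 1 * ‖W - 1‖ + ‖W - 1‖ := by gcongr
      _ ≤ 2 * (2 * Θ₀ * C) := by linarith
  calc ‖sunPosMap ι hinj u ε g N 0‖ = ‖sunCoordOf ι hinj (linkLog W)‖ := rfl
    _ ≤ ‖sunCoordOf (L := L) ι hinj‖ * ‖linkLog W‖ := ContinuousLinearMap.le_opNorm _ _
    _ ≤ ‖sunCoordOf (L := L) ι hinj‖ * (4 * Θ₀ * C) :=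
        mul_le_mul_of_nonneg_left (hlogW.trans (le_of_eq (by ring))) (norm_nonneg _)

end Approx

/-! ## §2 The chart kick of radius `r` -/

section Kick

variable [MeasurableSpace E] [BorelSpace E] (μ : Measure E) [μ.IsAddHaarMeasure]

/-- **The chart kick of radius `r`**: the normalised image of `μ|_{B(0,r)}` under the exponential, a
probability law on `SU(N)` (`r = 1` is `chartKick`). -/
def chartKickR (r : ℝ) : Measure (Matrix.specialUnitaryGroup n ℂ) :=
  (μ (ball (0 : E) r))⁻¹ • (μ.restrict (ball (0 : E) r)).map (suExp ι hι)

/-- The chart kick is `s`-finite. -/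
instance sFinite_chartKickR (r : ℝ) : SFinite (chartKickR ι hι μ r) := by
  unfold chartKickR; infer_instance

/-- The chart kick of positive radius is a probability law. -/
theorem isProbabilityMeasure_chartKickR {r : ℝ} (hr : 0 < r) : IsProbabilityMeasure (chartKickR ι hι μ r) := by
  refine ⟨?_⟩
  rw [chartKickR, Measure.smul_apply, smul_eq_mul, Measure.map_apply (continuous_suExp ι hι).measurable MeasurableSet.univ,
    preimage_univ, Measure.restrict_apply MeasurableSet.univ, univ_inter,
    ENNReal.inv_mul_cancel (measure_ball_pos μ _ hr).ne' measure_ball_lt_top.ne]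

omit [BorelSpace E] in
/-- `μ(B(0,r)) • chartKickR r = (μ|_{B(0,r)}) ∘ suExp⁻¹` (`r > 0`). -/
theorem smul_chartKickR_eq {r : ℝ} (hr : 0 < r) :
    μ (ball (0 : E) r) • chartKickR ι hι μ r = (μ.restrict (ball (0 : E) r)).map (suExp ι hι) := by
  rw [chartKickR, smul_smul, ENNReal.mul_inv_cancel (measure_ball_pos μ _ hr).ne' measure_ball_lt_top.ne, one_smul]

/-- One kicked link: `μ(B(0,r)) • (chartKickR r · w) = (μ|_{B(0,r)}) ∘ (a ↦ suExp a · w)⁻¹`. -/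
theorem smul_mulWalk_chartKickR_eq {r : ℝ} (hr : 0 < r) (w : Matrix.specialUnitaryGroup n ℂ) :
    μ (ball (0 : E) r) • mulWalk (chartKickR ι hι μ r) w = (μ.restrict (ball (0 : E) r)).map (fun a => suExp ι hι a * w) := by
  have hcomp : (fun a : E => suExp ι hι a * w) = (fun g : Matrix.specialUnitaryGroup n ℂ => g * w) ∘ suExp ι hι := rfl
  rw [mulWalk_apply, ← Measure.map_smul, smul_chartKickR_eq ι hι μ hr, hcomp,
    Measure.map_map (measurable_mul_const w) (continuous_suExp ι hι).measurable]

end Kick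

/-! ## §3 The law of the proposed configuration dominates the chart kick, from every base -/

section Law

variable [MeasurableSpace E] [BorelSpace E] (μ : Measure E) [μ.IsAddHaarMeasure]
variable {u : L → Matrix.specialUnitaryGroup n ℂ} {ε : ℝ} {g : (L → Matrix.specialUnitaryGroup n ℂ) → L → E} {N : ℕ}
variable {C b K ρ η ρL ηL : ℝ} {A : ℝ≥0}

/-- **THE POSITION LAW OF `n` SHORT LEAPFROG STEPS DOMINATES THE CHART KICK OF RADIUS `nε/3`.**
At base `U`, under the standing hypotheses, with `Θ₁ = nε‖J‖(1 + (2n+1)b) ≤ ρ`, `plfSmall ≤ 1`,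
`‖coordOf‖(2η_L + plfSmall)‖J‖ ≤ 1/3`, a logarithm defect `0 ≤ η_L ≤ 1` on a radius `ρ_L ≥ 2Θ₁C` at which
special unitary matrices lie in the chart set, the centre condition `4‖coordOf‖Θ₀C ≤ nε/3`, and the
Lipschitz image constant `A ≠ 0` of `μ^{⊗links}`: for every measurable `B`,
`(A·(4nε/3))^{−dim} μ(B(0,nε/3))^{|links|} · ((⊗ chartKickR (nε/3))·U)(B) ≤ μ^{⊗links}{p ∈ B̄(0,1) | (Ψ_n(U,p)).1 ∈ B}`. -/
theorem sunLeapfrogProposalN_position_law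
    (hsurj : ∀ X : Matrix n n ℂ, Xᴴ = -X → X.trace = 0 → X ∈ LinearMap.range ι)
    (h : PLFBounds linkExp (sunJ ι) (algForce u g) sunGroupSet C b K ρ η) (hε : 0 < ε) (hN : 1 ≤ N)
    (hΘρ : N * (ε * ‖sunJ (L := L) ι‖ * (1 + (2 * N + 1) * b)) ≤ ρ)
    (hS1 : plfSmall (sunJ (L := L) ι) C K η ε b 1 N ≤ 1)
    (hS : ‖sunCoordOf (L := L) ι hinj‖ * (2 * ηL + plfSmall (sunJ (L := L) ι) C K η ε b 1 N) * ‖sunJ (L := L) ι‖ ≤ 1 / 3)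
    (hηL : 0 ≤ ηL) (hηL1 : ηL ≤ 1)
    (hlog : ∀ W W' : L → Matrix n n ℂ, ‖W - 1‖ ≤ ρL → ‖W' - 1‖ ≤ ρL →
      ‖linkLog W - linkLog W' - (W - W')‖ ≤ ηL * ‖W - W'‖)
    (hchart : ∀ U : Matrix.specialUnitaryGroup n ℂ, ‖(U : Matrix n n ℂ) - 1‖ ≤ ρL → U ∈ suChartSet (n := n))
    (hΘL : 2 * (N * (ε * ‖sunJ (L := L) ι‖ * (1 + (2 * N + 1) * b))) * C ≤ ρL)
    (hcentre : ‖sunCoordOf (L := L) ι hinj‖ * (4 * (N * (ε * ‖sunJ (L := L) ι‖ * (0 + (2 * N + 1) * b))) * C) ≤ N * ε / 3)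
    (hA0 : A ≠ 0)
    (hA : ∀ (K' : ℝ≥0) (f : (L → E) → L → E) (s : Set (L → E)), LipschitzOnWith K' f s →
      Measure.pi (fun _ : L => μ) (f '' s) ≤ ((A * K' : ℝ≥0) : ℝ≥0∞) ^ Module.finrank ℝ (L → E) * Measure.pi (fun _ : L => μ) s)
    {B : Set (L → Matrix.specialUnitaryGroup n ℂ)} (hB : MeasurableSet B) :
    ((((A * Real.toNNReal (N * ε + N * ε / 3) : ℝ≥0) : ℝ≥0∞) ^ Module.finrank ℝ (L → E))⁻¹ *
        μ (ball (0 : E) (N * ε / 3)) ^ Fintype.card L) *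
      mulWalk (Measure.pi fun _ : L => chartKickR ι hι μ (N * ε / 3)) u B ≤
      Measure.pi (fun _ : L => μ)
        ((fun p : L → E => (sunLeapfrogProposalN ι hι ε g N (u, p)).1) ⁻¹' B ∩ closedBall (0 : L → E) 1) := by
  classical
  set τ : ℝ := N * ε with hτdef
  set r : ℝ := N * ε / 3 with hrdef
  have hN1 : (1 : ℝ) ≤ N := by exact_mod_cast hN
  have hτ : 0 < τ := by positivity
  have hr : 0 < r := by positivity
  set Ps : (L → E) → L → E := sunPosMap ι hinj u ε g N with hPs
  set Eu : (L → E) → L → Matrix.specialUnitaryGroup n ℂ := fun x l => suExp ι hι (x l) * u l with hEu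
  have hEu_meas : Measurable Eu :=
    measurable_pi_lambda _ fun l => ((continuous_suExp ι hι).comp (continuous_apply l)).measurable.mul_const _
  -- Step 1: on the unit ball the proposed configuration is `Eu (Ps p)`
  have hΘρ' : ∀ {p : L → E}, ‖p‖ ≤ 1 → ‖(plfTraj linkExp (sunJ ι) (algForce u g) ε p N).1 - 1‖ ≤ ρL :=
    fun hp => (norm_plfTraj_fst_sub_one_le' ι h hε.le hN hp hΘρ).trans hΘL
  have hstep1 : ∀ p ∈ closedBall (0 : L → E) 1, (sunLeapfrogProposalN ι hι ε g N (u, p)).1 = Eu (Ps p) :=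
    fun p hp => fst_sunLeapfrogProposalN_eq ι hι hinj hsurj hchart (hΘρ' (mem_closedBall_zero_iff.1 hp))
  -- Step 2: `Ps` is an approximate dilation by `τ` with constant `τ/3` on the unit ball
  have happrox : ∀ p ∈ closedBall (0 : L → E) 1, ∀ p' ∈ closedBall (0 : L → E) 1,
      ‖Ps p - Ps p' - τ • (p - p')‖ ≤ τ / 3 * ‖p - p'‖ := by
    intro p hp p' hp'
    have h1 := sunPosMap_approx ι hinj h hε.le hN (mem_closedBall_zero_iff.1 hp) (mem_closedBall_zero_iff.1 hp') hΘρ hS1 hηL hlog hΘL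
    refine h1.trans ?_
    have h2 : ‖sunCoordOf (L := L) ι hinj‖ * (2 * ηL + plfSmall (sunJ (L := L) ι) C K η ε b 1 N) * ((N : ℝ) * ε * ‖sunJ (L := L) ι‖) =
        (‖sunCoordOf (L := L) ι hinj‖ * (2 * ηL + plfSmall (sunJ (L := L) ι) C K η ε b 1 N) * ‖sunJ (L := L) ι‖) * τ := by
      rw [hτdef]; ring
    rw [h2]
    have h3 : (‖sunCoordOf (L := L) ι hinj‖ * (2 * ηL + plfSmall (sunJ (L := L) ι) C K η ε b 1 N) * ‖sunJ (L := L) ι‖) * τ ≤ 1 / 3 * τ :=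
      mul_le_mul_of_nonneg_right hS hτ.le
    have := mul_le_mul_of_nonneg_right h3 (norm_nonneg (p - p'))
    linarith
  -- Step 3: the centre
  have hcen : r + ‖Ps 0‖ ≤ (τ - τ / 3) * 1 := by
    have h1 := norm_sunPosMap_zero_le ι hinj h hε.le hN (ρL := ρL) (ηL := ηL) ?_ hηL1 hlog ?_
    · rw [hrdef, hτdef]; linarith [h1.trans hcentre]
    · refine le_trans ?_ hΘρ
      have hb0 := h.force_bound_nonneg
      gcongr; linarith
    · refine le_trans ?_ hΘL
      have hb0 := h.force_bound_nonneg
      have hC0 : 0 ≤ C := zero_le_one.trans h.one_le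
      gcongr; linarith
  -- Step 4: the local dilation push-forward, with `B' = Eu⁻¹ B`
  have hτ3 : τ / 3 < τ := by linarith
  have hpre := addHaar_inter_ball_le_of_approxOn (Measure.pi fun _ : L => μ) hA hτ3 (by positivity) zero_le_one happrox hcen (Eu ⁻¹' B)
  -- Step 5: the preimages agree on the unit ball
  have hsub : Ps ⁻¹' (Eu ⁻¹' B) ∩ closedBall 0 1 ⊆
      (fun p : L → E => (sunLeapfrogProposalN ι hι ε g N (u, p)).1) ⁻¹' B ∩ closedBall (0 : L → E) 1 := by
    rintro p ⟨hpB, hp⟩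
    refine ⟨?_, hp⟩
    rw [mem_preimage, hstep1 p hp]; exact hpB
  -- Step 6: `μ(B(0,r))^{|L|} • (⊗ chartKickR r)·u ≤ (μ^⊗|_{B(0,r)}) ∘ Eu⁻¹`
  haveI := isProbabilityMeasure_chartKickR ι hι μ hr
  haveI : IsFiniteMeasure (μ.restrict (ball (0 : E) r)) := ⟨by rw [Measure.restrict_apply_univ]; exact measure_ball_lt_top⟩
  have hpi : μ (ball (0 : E) r) ^ Fintype.card L • mulWalk (Measure.pi fun _ : L => chartKickR ι hι μ r) u ≤
      ((Measure.pi fun _ : L => μ).restrict (ball (0 : L → E) r)).map Eu := by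
    rw [ball_pi _ hr, ← pi_mulWalk, Measure.restrict_pi_pi]
    have hmap : ((Measure.pi fun l : L => μ.restrict (ball ((0 : L → E) l) r))).map Eu =
        Measure.pi fun l : L => (μ.restrict (ball (0 : E) r)).map (fun a => suExp ι hι a * u l) := by
      rw [hEu]
      exact Measure.pi_map_pi (fun l => (show Measurable (fun a : E => suExp ι hι a * u l) from
        (continuous_suExp ι hι).measurable.mul_const _).aemeasurable)
    rw [hmap]
    have hle := smul_pi_le_pi (c := fun _ : L => μ (ball (0 : E) r)) (μ := fun l : L => mulWalk (chartKickR ι hι μ r) (u l))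
      (ν := fun l : L => (μ.restrict (ball (0 : E) r)).map (fun a => suExp ι hι a * u l))
      fun l => (smul_mulWalk_chartKickR_eq ι hι μ hr (u l)).le
    rwa [Finset.prod_const, Finset.card_univ] at hle
  -- assemble
  have hchain : μ (ball (0 : E) r) ^ Fintype.card L * mulWalk (Measure.pi fun _ : L => chartKickR ι hι μ r) u B ≤
      ((A * Real.toNNReal (τ + τ / 3) : ℝ≥0) : ℝ≥0∞) ^ Module.finrank ℝ (L → E) *
        Measure.pi (fun _ : L => μ) ((fun p : L → E => (sunLeapfrogProposalN ι hι ε g N (u, p)).1) ⁻¹' B ∩ closedBall (0 : L → E) 1) := by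
    calc μ (ball (0 : E) r) ^ Fintype.card L * mulWalk (Measure.pi fun _ : L => chartKickR ι hι μ r) u B
        ≤ (((Measure.pi fun _ : L => μ).restrict (ball (0 : L → E) r)).map Eu) B := by
          have := Measure.le_iff'.1 hpi B; rwa [Measure.smul_apply, smul_eq_mul] at this
      _ = Measure.pi (fun _ : L => μ) (Eu ⁻¹' B ∩ ball 0 r) := by
          rw [Measure.map_apply hEu_meas hB, Measure.restrict_apply (hEu_meas hB)]
      _ ≤ ((A * Real.toNNReal (τ + τ / 3) : ℝ≥0) : ℝ≥0∞) ^ Module.finrank ℝ (L → E) *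
            Measure.pi (fun _ : L => μ) (Ps ⁻¹' (Eu ⁻¹' B) ∩ closedBall 0 1) := hpre
      _ ≤ _ := by gcongr
  have hM0 : ((A * Real.toNNReal (τ + τ / 3) : ℝ≥0) : ℝ≥0∞) ^ Module.finrank ℝ (L → E) ≠ 0 := by
    refine pow_ne_zero _ (ENNReal.coe_ne_zero.2 (mul_ne_zero hA0 ?_))
    rw [Ne, Real.toNNReal_eq_zero, not_le]; positivity
  have hMtop : ((A * Real.toNNReal (τ + τ / 3) : ℝ≥0) : ℝ≥0∞) ^ Module.finrank ℝ (L → E) ≠ ⊤ :=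
    ENNReal.pow_ne_top ENNReal.coe_ne_top
  calc ((((A * Real.toNNReal (τ + τ / 3) : ℝ≥0) : ℝ≥0∞) ^ Module.finrank ℝ (L → E))⁻¹ * μ (ball (0 : E) r) ^ Fintype.card L) *
        mulWalk (Measure.pi fun _ : L => chartKickR ι hι μ r) u B
      = (((A * Real.toNNReal (τ + τ / 3) : ℝ≥0) : ℝ≥0∞) ^ Module.finrank ℝ (L → E))⁻¹ *
          (μ (ball (0 : E) r) ^ Fintype.card L * mulWalk (Measure.pi fun _ : L => chartKickR ι hι μ r) u B) := by rw [mul_assoc]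
    _ ≤ (((A * Real.toNNReal (τ + τ / 3) : ℝ≥0) : ℝ≥0∞) ^ Module.finrank ℝ (L → E))⁻¹ *
          (((A * Real.toNNReal (τ + τ / 3) : ℝ≥0) : ℝ≥0∞) ^ Module.finrank ℝ (L → E) *
            Measure.pi (fun _ : L => μ) ((fun p : L → E => (sunLeapfrogProposalN ι hι ε g N (u, p)).1) ⁻¹' B ∩ closedBall (0 : L → E) 1)) := by
        gcongr
    _ = Measure.pi (fun _ : L => μ) ((fun p : L → E => (sunLeapfrogProposalN ι hι ε g N (u, p)).1) ⁻¹' B ∩ closedBall (0 : L → E) 1) := by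
        rw [← mul_assoc, ENNReal.inv_mul_cancel hM0 hMtop, one_mul]

end Law

end Summit.Ventures.LatticeQCDFlow.Exactness
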